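import Mathlib
import Summits.ValiantsHypothesis.ValiantsHypothesis.Theorems.LiouvilleSarnakLiouvilleCutRankMultiplicativeBarrier
import Summits.ValiantsHypothesis.ValiantsHypothesis.Theorems.LiouvilleSarnakLiouvilleCutRankScatteredBlocksFilledIdentities

/-!
# Route LiouvilleSarnak — crux `LiouvilleCutRank` (stmt-ValiantsHypothesis-14775):
# the FILLER DEFEATS THE AUTOMATIC TWIN — filled scattered-block matrices of `(-1)^{v₂} χ₄` have unboundedly many rows

The positive counterpart of `…ScatteredBlocksBarrier` (p831533).  There, the completely multiplicative twin
`f(2^v M) = (-1)^v χ₄(M)` of `λ` — which has every input used so far (`f(2m) = -f(m)`, `f(3m) = -f(m)`, complete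
multiplicativity, `f ≡ -1` on `3 (mod 4)`) — was shown to have ZERO-filler scattered-block rank `≤ 1` whenever the first gap
is `≥ 4`, so the zero-filler hypothesis of `…ScatteredBlocks` cannot be proved from those inputs.  Here: with the GAP-ONES
filler of `…ScatteredBlocksFiller` / `…ScatteredBlocksFilledIdentities` the same `f` has at least `t + 2` distinct rows on
EVERY configuration of `t + 1` blocks with gaps `≥ 3` (hence rank `≥ log₂ (t + 2) → ∞`):

* §1 `filled_split`, `filled_carry_bool`, `one_le_filled` — bottom-digit arithmetic of the filled number
  (`N = 2^{g 1} N' - 3 + (2 x_0 + y_0)`, `N'` the tail's filled number, via `…FilledIdentities.filled_carry`).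
* §2 ★ `exists_completelyMultiplicative_filled_distinctRows` — the statement.  Mechanism: the rows with `x_0 = 1` restricted
  to the columns with `y_0 = 1` are `±` the tail matrix (carry), their other entries are `f(2^{g 1} N' - 1) = -1`, and every
  row with `x_0 = 0` is the constant row `+1` (`f(2^{g 1} N' - 2) = f(2)·f(2^{g 1 - 1} N' - 1) = 1`, `f(2^{g 1} N' - 3) = 1`);
  so each block adds exactly one new row.

Reading for the line (honest): the automatic completely multiplicative twins are NOT a barrier for the FILLED scattered-block
hypothesis — consistent with the numerics of this hand (filled rank of `χ₄, χ₈, χ₄χ₈`-twists `≈` number of blocks, of `λ`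
full) and with the conjecture «filled rank `≥` number of blocks for every completely multiplicative `f` with `f(2) = -1`»,
whose proof would settle `LiouvilleCutRank` via `…ScatteredBlocksFiller` + `…BoundedChanges`.  Nothing here is a case of the
crux; `LiouvilleCutRank`, `DigitalBilinearLiouville`, `AlgebraicSarnak` stay OPEN; nothing bears on `VP ≠ VNP`.  No definitions
(the witness is an explicit term).
-/

set_option linter.dupNamespace false

noncomputable section

namespace Summit.ValiantsHypothesis.ValiantsHypothesis.Theorems.LiouvilleSarnakLiouvilleCutRank.ScatteredBlocksFilledTwin

open Finset

open Summit.ValiantsHypothesis.ValiantsHypothesis.Theorems.LiouvilleSarnakLiouvilleCutRank.MultiplicativeBarrier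
  (witness_two_pow_mul_odd exists_eq_two_pow_mul_odd sign_mul_of_odd)
open Summit.ValiantsHypothesis.ValiantsHypothesis.Theorems.LiouvilleSarnakLiouvilleCutRank.ScatteredBlocksFilledIdentities
  (filled_carry)

/-! ### §1 Arithmetic of the filled number at the bottom block -/

/-- Splitting off the bottom digit: with `g 0 = 0` the filled number is `C + (2 x_0 + y_0)` where `C` depends only on the
tails of `x, y`. [folklore] -/
theorem filled_split (t : ℕ) (g : Fin (t + 2) → ℕ) (hg0 : g 0 = 0) (x y : Fin (t + 2) → Bool) :
    (1 + ∑ i : Fin (t + 1), (2 ^ (g i.succ) - 2 ^ (g (Fin.castSucc i) + 2))) +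
        ∑ i : Fin (t + 2), (2 * (x i).toNat + (y i).toNat) * 2 ^ (g i) =
      ((1 + ∑ i : Fin (t + 1), (2 ^ (g i.succ) - 2 ^ (g (Fin.castSucc i) + 2))) +
        ∑ i : Fin (t + 1), (2 * (x i.succ).toNat + (y i.succ).toNat) * 2 ^ (g i.succ)) +
      (2 * (x 0).toNat + (y 0).toNat) := by
  rw [Fin.sum_univ_succ (f := fun i : Fin (t + 2) => (2 * (x i).toNat + (y i).toNat) * 2 ^ (g i)), hg0, pow_zero,
    mul_one]
  ring

/-- The carry class: for `x 0 = y 0 = true` the filled number is `2^{g 1}` times the filled number of the tail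
configuration at the tails of `x, y` (from `ScatteredBlocksFilledIdentities.filled_carry`). [this file] -/
theorem filled_carry_bool (t : ℕ) (g : Fin (t + 2) → ℕ) (hg0 : g 0 = 0)
    (hg : ∀ i j : Fin (t + 2), i < j → g i + 2 ≤ g j) (x y : Fin (t + 2) → Bool)
    (hx : x 0 = true) (hy : y 0 = true) :
    (1 + ∑ i : Fin (t + 1), (2 ^ (g i.succ) - 2 ^ (g (Fin.castSucc i) + 2))) +
        ∑ i : Fin (t + 2), (2 * (x i).toNat + (y i).toNat) * 2 ^ (g i) =
      2 ^ (g 1) * ((1 + ∑ i : Fin t, (2 ^ (g i.succ.succ - g 1) - 2 ^ ((g (Fin.castSucc i).succ - g 1) + 2))) +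
        ∑ i : Fin (t + 1), (2 * (x i.succ).toNat + (y i.succ).toNat) * 2 ^ (g i.succ - g 1)) := by
  have h := filled_carry t g hg0 hg (fun i => 2 * (x i).toNat + (y i).toNat) (by simp [hx, hy])
  exact_mod_cast h

/-- Positivity of the tail filled number: it is at least `1`. [folklore] -/
theorem one_le_filled (t : ℕ) (g : Fin (t + 1) → ℕ) (x y : Fin (t + 1) → Bool) :
    1 ≤ (1 + ∑ i : Fin t, (2 ^ (g i.succ) - 2 ^ (g (Fin.castSucc i) + 2))) +
        ∑ i : Fin (t + 1), (2 * (x i).toNat + (y i).toNat) * 2 ^ (g i) := by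
  omega

/-! ### §2 The twin's filled matrices have unboundedly many distinct rows -/

/-- ★ **The filler defeats the automatic twin.**  There is a completely multiplicative `f : ℕ → {±1}` with `f(2) = -1`,
`f(m) = -1` for all `m ≡ 3 (mod 4)` — the witness `(-1)^{v₂} χ₄` of `…MultiplicativeBarrier` and `…ScatteredBlocksBarrier`,
whose ZERO-filler scattered-block matrices have rank `≤ 1` — such that for EVERY block configuration `0 = g 0`, gaps `≥ 3`,
its GAP-ONES-FILLED scattered-block matrix `(f(1 + H + Σ_i (2 x_i + y_i) 2^{g i}))_{x,y}` has at least `t + 2` distinct rows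
(`t + 1` blocks; hence rank `≥ log₂ (t + 2) → ∞`).  Proof: with bottom digit `3` the carry reproduces `±` the tail matrix
(`filled_carry`), the other entries of those rows are `f(2^{g 1} m - 1) = -1`, and the rows with `x_0 = 0` are constant `+1`
(`f(2^{g 1} m - 2) = f(2) f(2^{g 1 - 1} m - 1) = 1`, `f(2^{g 1} m - 3) = 1`): one new row per block. [this file] -/
theorem exists_completelyMultiplicative_filled_distinctRows :
    ∃ f : ℕ → ℤ, (∀ m, 1 ≤ m → f m = 1 ∨ f m = -1) ∧ (∀ a b, 1 ≤ a → 1 ≤ b → f (a * b) = f a * f b) ∧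
      f 2 = -1 ∧ (∀ m, m % 4 = 3 → f m = -1) ∧
      ∀ (t : ℕ) (g : Fin (t + 1) → ℕ), g 0 = 0 → (∀ i j : Fin (t + 1), i < j → g i + 3 ≤ g j) →
        t + 2 ≤ ((Finset.univ : Finset (Fin (t + 1) → Bool)).image fun x : Fin (t + 1) → Bool =>
          fun y : Fin (t + 1) → Bool =>
            ((f ((1 + ∑ i : Fin t, (2 ^ (g i.succ) - 2 ^ (g (Fin.castSucc i) + 2))) +
              ∑ i : Fin (t + 1), (2 * (x i).toNat + (y i).toNat) * 2 ^ (g i)) : ℤ) : ℂ)).card := by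
  classical
  let f : ℕ → ℤ := fun m =>
    (-1 : ℤ) ^ (m.factorization 2) * (if (m / 2 ^ (m.factorization 2)) % 4 = 3 then -1 else 1)
  have hf : ∀ v M : ℕ, M % 2 = 1 → f (2 ^ v * M) = (-1 : ℤ) ^ v * (if M % 4 = 3 then -1 else 1) :=
    fun v M hM => witness_two_pow_mul_odd v M hM
  have hCM : ∀ a b, 1 ≤ a → 1 ≤ b → f (a * b) = f a * f b := by
    intro a b ha hb
    obtain ⟨v, M, hM, rfl⟩ := exists_eq_two_pow_mul_odd a (by omega)
    obtain ⟨v', M', hM', rfl⟩ := exists_eq_two_pow_mul_odd b (by omega)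
    have hMM : (M * M') % 2 = 1 := by
      have := Nat.mul_mod M M' 2; rw [hM, hM'] at this; simpa using this
    rw [show 2 ^ v * M * (2 ^ v' * M') = 2 ^ (v + v') * (M * M') by ring, hf _ _ hMM, hf v M hM,
      hf v' M' hM', sign_mul_of_odd M M' hM hM', pow_add]
    ring
  have h2 : f 2 = -1 := by have := hf 1 1 (by norm_num); simpa using this
  have h3mod : ∀ m, m % 4 = 3 → f m = -1 := by
    intro m hm
    have h1 : m % 2 = 1 := by omega
    have := hf 0 m h1
    simp only [pow_zero, one_mul, hm, if_true] at this
    simpa using this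
  have h1mod : ∀ m, m % 4 = 1 → f m = 1 := by
    intro m hm
    have h1 : m % 2 = 1 := by omega
    have := hf 0 m h1
    simp only [pow_zero, one_mul, show ¬ (m % 4 = 3) by omega, if_false] at this
    simpa using this
  have hpow : ∀ a m : ℕ, 1 ≤ m → f (2 ^ a * m) = (-1) ^ a * f m := by
    intro a m hm
    induction a with
    | zero => simp
    | succ a ih =>
      have h1 : 1 ≤ 2 ^ a * m :=
        Nat.one_le_iff_ne_zero.mpr (Nat.mul_ne_zero (pow_ne_zero _ two_ne_zero) (by omega))
      rw [show (2 : ℕ) ^ (a + 1) * m = 2 * (2 ^ a * m) by ring, hCM 2 (2 ^ a * m) (by norm_num) h1, ih, h2,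
        pow_succ]
      ring
  refine ⟨f, fun m hm => ?_, hCM, h2, h3mod, ?_⟩
  · obtain ⟨v, M, hM, rfl⟩ := exists_eq_two_pow_mul_odd m (by omega)
    rw [hf v M hM]
    rcases neg_one_pow_eq_or ℤ v with h | h <;> rw [h] <;> split_ifs <;> simp
  intro t
  induction t with
  | zero =>
    intro g hg0 _
    -- two distinct rows: `x = true` gives `(f 3, f 4)`, `x = false` gives `(f 1, f 2)`; they differ at `y = false`
    have hft : f 3 = -1 := h3mod 3 (by norm_num)
    have hf1 : f 1 = 1 := h1mod 1 (by norm_num)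
    rw [show (0 : ℕ) + 2 = 2 from rfl]
    apply Finset.one_lt_card.mpr
    refine ⟨_, Finset.mem_image_of_mem _ (Finset.mem_univ (fun _ => true)),
      _, Finset.mem_image_of_mem _ (Finset.mem_univ (fun _ => false)), ?_⟩
    intro heq
    have h := congrFun heq (fun _ => false)
    simp only [Fin.sum_univ_zero, Bool.toNat_true, Bool.toNat_false, mul_one, mul_zero, add_zero] at h
    rw [Fin.sum_univ_succ, Fin.sum_univ_zero, hg0] at h
    norm_num at h
    rw [hft, hf1] at h
    norm_num at h
  | succ t ih =>
    intro g hg0 hg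
    have hg2 : ∀ i j : Fin (t + 2), i < j → g i + 2 ≤ g j := fun i j hij => by have := hg i j hij; omega
    have hg1 : 3 ≤ g 1 := by have := hg 0 1 (by simp); omega
    have hmono : ∀ i : Fin (t + 1), g 1 ≤ g i.succ := by
      intro i
      rcases eq_or_lt_of_le (show (1 : Fin (t + 2)) ≤ i.succ from by rw [Fin.le_def]; simp) with h | h
      · rw [← h]
      · have := hg 1 i.succ h; omega
    -- the tail configuration
    set g' : Fin (t + 1) → ℕ := fun i => g i.succ - g 1 with hg'
    have hg'0 : g' 0 = 0 := by simp [hg']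
    have hg'gap : ∀ i j : Fin (t + 1), i < j → g' i + 3 ≤ g' j := by
      intro i j hij
      have := hg i.succ j.succ (Fin.succ_lt_succ_iff.mpr hij)
      have := hmono i; have := hmono j
      simp only [hg']; omega
    have hih := ih g' hg'0 hg'gap
    -- notation: filled numbers and rows
    let N : (Fin (t + 2) → Bool) → (Fin (t + 2) → Bool) → ℕ := fun x y =>
      (1 + ∑ i : Fin (t + 1), (2 ^ (g i.succ) - 2 ^ (g (Fin.castSucc i) + 2))) +
        ∑ i : Fin (t + 2), (2 * (x i).toNat + (y i).toNat) * 2 ^ (g i)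
    let N' : (Fin (t + 1) → Bool) → (Fin (t + 1) → Bool) → ℕ := fun u v =>
      (1 + ∑ i : Fin t, (2 ^ (g' i.succ) - 2 ^ (g' (Fin.castSucc i) + 2))) +
        ∑ i : Fin (t + 1), (2 * (u i).toNat + (v i).toNat) * 2 ^ (g' i)
    let row : (Fin (t + 2) → Bool) → (Fin (t + 2) → Bool) → ℂ := fun x y => ((f (N x y) : ℤ) : ℂ)
    let row' : (Fin (t + 1) → Bool) → (Fin (t + 1) → Bool) → ℂ := fun u v => ((f (N' u v) : ℤ) : ℂ)
    show t + 1 + 2 ≤ ((Finset.univ : Finset (Fin (t + 2) → Bool)).image row).card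
    change t + 2 ≤ ((Finset.univ : Finset (Fin (t + 1) → Bool)).image row').card at hih
    -- (1) the carry: `N (cons true u) (cons true v) = 2^{g 1} * N' u v`
    have hcarry : ∀ u v : Fin (t + 1) → Bool,
        N (Fin.cons true u) (Fin.cons true v) = 2 ^ (g 1) * N' u v := by
      intro u v
      have h := filled_carry_bool t g hg0 hg2 (Fin.cons true u) (Fin.cons true v) rfl rfl
      simp only [Fin.cons_succ] at h
      exact h
    -- (2) the bottom digit: `N (cons a u) (cons b v) + 3 = 2^{g 1} N' u v + (2a + b)`
    have hsplit : ∀ (a b : Bool) (u v : Fin (t + 1) → Bool),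
        N (Fin.cons a u) (Fin.cons b v) + 3 = 2 ^ (g 1) * N' u v + (2 * a.toNat + b.toNat) := by
      intro a b u v
      have h1 := filled_split t g hg0 (Fin.cons a u) (Fin.cons b v)
      have h2 := filled_split t g hg0 (Fin.cons true u) (Fin.cons true v)
      have h3 := hcarry u v
      simp only [N, N'] at h3 ⊢
      simp only [Fin.cons_succ, Fin.cons_zero, Bool.toNat_true] at h1 h2 h3 ⊢
      omega
    have hN'pos : ∀ u v, 1 ≤ N' u v := fun u v => one_le_filled t g' u v
    have h4dvd : 4 ∣ 2 ^ (g 1) := by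
      rw [show (4 : ℕ) = 2 ^ 2 by norm_num]; exact Nat.pow_dvd_pow 2 (by omega)
    -- (3) the entries
    have hA : ∀ u v : Fin (t + 1) → Bool,
        row (Fin.cons true u) (Fin.cons true v) = (-1 : ℂ) ^ (g 1) * row' u v := by
      intro u v
      simp only [row, row']
      rw [hcarry u v, hpow _ _ (hN'pos u v)]
      push_cast; ring
    have hB : ∀ u v : Fin (t + 1) → Bool, row (Fin.cons true u) (Fin.cons false v) = -1 := by
      intro u v
      have h := hsplit true false u v
      simp only [Bool.toNat_true, Bool.toNat_false, mul_one, add_zero] at h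
      have hm : N (Fin.cons true u) (Fin.cons false v) % 4 = 3 := by
        have hpos := hN'pos u v
        obtain ⟨K, hK⟩ : 4 ∣ 2 ^ g 1 * N' u v := dvd_mul_of_dvd_left h4dvd _
        have hK1 : 1 ≤ 2 ^ g 1 * N' u v :=
          Nat.one_le_iff_ne_zero.mpr (Nat.mul_ne_zero (pow_ne_zero _ two_ne_zero) (by omega))
        omega
      simp only [row]
      rw [h3mod _ hm]
      norm_num
    have hC : ∀ (u : Fin (t + 1) → Bool) (y : Fin (t + 2) → Bool), row (Fin.cons false u) y = 1 := by
      intro u y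
      obtain ⟨b, v, rfl⟩ : ∃ (b : Bool) (v : Fin (t + 1) → Bool), y = Fin.cons b v :=
        ⟨y 0, Fin.tail y, (Fin.cons_self_tail y).symm⟩
      have hpos := hN'pos u v
      have hK1 : 1 ≤ 2 ^ g 1 * N' u v :=
        Nat.one_le_iff_ne_zero.mpr (Nat.mul_ne_zero (pow_ne_zero _ two_ne_zero) (by omega))
      simp only [row]
      cases b
      · -- `N = 2^{g1} N' - 3 ≡ 1 (mod 4)`
        have h := hsplit false false u v
        simp only [Bool.toNat_false, mul_zero, add_zero] at h
        obtain ⟨K, hK⟩ : 4 ∣ 2 ^ g 1 * N' u v := dvd_mul_of_dvd_left h4dvd _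
        have hm : N (Fin.cons false u) (Fin.cons false v) % 4 = 1 := by omega
        rw [h1mod _ hm]; norm_num
      · -- `N = 2^{g1} N' - 2 = 2 (2^{g1-1} N' - 1)`, second factor `≡ 3 (mod 4)`
        have h := hsplit false true u v
        simp only [Bool.toNat_false, Bool.toNat_true, mul_zero, zero_add] at h
        have hg1' : 2 ^ g 1 * N' u v = 2 * (2 ^ (g 1 - 1) * N' u v) := by
          rw [← mul_assoc, ← pow_succ']; congr 2; omega
        obtain ⟨K, hK⟩ : 4 ∣ 2 ^ (g 1 - 1) * N' u v := by
          refine dvd_mul_of_dvd_left ?_ _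
          rw [show (4 : ℕ) = 2 ^ 2 by norm_num]; exact Nat.pow_dvd_pow 2 (by omega)
        have hP1 : 1 ≤ 2 ^ (g 1 - 1) * N' u v :=
          Nat.one_le_iff_ne_zero.mpr (Nat.mul_ne_zero (pow_ne_zero _ two_ne_zero) (by omega))
        have hN : N (Fin.cons false u) (Fin.cons true v) = 2 * (2 ^ (g 1 - 1) * N' u v - 1) := by omega
        have hm : (2 ^ (g 1 - 1) * N' u v - 1) % 4 = 3 := by omega
        rw [hN, hCM 2 _ (by norm_num) (by omega), h2, h3mod _ hm]
        norm_num
    -- (4) counting distinct rows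
    set T₁ : Finset ((Fin (t + 2) → Bool) → ℂ) :=
      (Finset.univ : Finset (Fin (t + 1) → Bool)).image (fun u => row (Fin.cons true u)) with hT₁
    have hone : (fun _ : Fin (t + 2) → Bool => (1 : ℂ)) ∉ T₁ := by
      intro hmem
      rw [hT₁, Finset.mem_image] at hmem
      obtain ⟨u, -, hu⟩ := hmem
      have h := congrFun hu (Fin.cons false (fun _ => false))
      rw [hB] at h
      norm_num at h
    have hsub : insert (fun _ : Fin (t + 2) → Bool => (1 : ℂ)) T₁ ⊆
        (Finset.univ : Finset (Fin (t + 2) → Bool)).image row := by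
      intro r hr
      rw [Finset.mem_insert] at hr
      rcases hr with rfl | hr
      · exact Finset.mem_image.mpr ⟨Fin.cons false (fun _ => false), Finset.mem_univ _, funext (hC _)⟩
      · rw [hT₁, Finset.mem_image] at hr
        obtain ⟨u, -, rfl⟩ := hr
        exact Finset.mem_image_of_mem _ (Finset.mem_univ _)
    -- the tail rows are recovered from `T₁`
    let Ψ : ((Fin (t + 2) → Bool) → ℂ) → ((Fin (t + 1) → Bool) → ℂ) := fun r v =>
      (-1 : ℂ) ^ (g 1) * r (Fin.cons true v)
    have hΨ : (Finset.univ : Finset (Fin (t + 1) → Bool)).image row' ⊆ T₁.image Ψ := by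
      intro r hr
      rw [Finset.mem_image] at hr
      obtain ⟨u, -, rfl⟩ := hr
      refine Finset.mem_image.mpr ⟨row (Fin.cons true u), ?_, ?_⟩
      · rw [hT₁]; exact Finset.mem_image_of_mem _ (Finset.mem_univ _)
      · funext v
        simp only [Ψ]
        rw [hA, ← mul_assoc, ← mul_pow]
        norm_num
    calc t + 1 + 2 = (t + 2) + 1 := by ring
      _ ≤ ((Finset.univ : Finset (Fin (t + 1) → Bool)).image row').card + 1 := by omega
      _ ≤ (T₁.image Ψ).card + 1 := by have := Finset.card_le_card hΨ; omega
      _ ≤ T₁.card + 1 := by have := Finset.card_image_le (s := T₁) (f := Ψ); omega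
      _ = (insert (fun _ : Fin (t + 2) → Bool => (1 : ℂ)) T₁).card := (Finset.card_insert_of_notMem hone).symm
      _ ≤ ((Finset.univ : Finset (Fin (t + 2) → Bool)).image row).card := Finset.card_le_card hsub

end Summit.ValiantsHypothesis.ValiantsHypothesis.Theorems.LiouvilleSarnakLiouvilleCutRank.ScatteredBlocksFilledTwin

end
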